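import Literature.MathematicalPhysics.QuantumFieldTheory.Balaban1983to89.B8Thm4TruncationLocalRec
import Literature.MathematicalPhysics.QuantumFieldTheory.Balaban1983to89.B8Prop5SocketDatum

/-!
# `Balaban1983to89.B8Prop5SocketDatumRec` — RECORD TWIN of `B8Prop5SocketDatum` §1 ∕ §5 ([Balaban1985RegularSpaces] pp. 88–90: the DATUM SIDE of the
# Proposition-5 socket — locality of the axial class `Ax_k(𝔅_k, U₀)` (1.19) on the towers, and «hence u₁ satisfies (1.29)» lifted from the truncated structure)
# for the SYMMETRISED CENTRED block averaging (0.4) of [Balaban1987RG1]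

statement-level skeleton of published theorems with citation tags; proofs where landed; nothing here is a claim about the Yang–Mills mass gap

T. Bałaban, *Spaces of regular gauge field configurations on a lattice and gauge fixing conditions*, Commun. Math. Phys. **99** (1985) 75–102
`[Balaban1985RegularSpaces]` ("[6]"): (1.19)–(1.20) p. 79, (1.29) p. 81, (1.34) p. 82, (1.68) p. 88, p. 89 («we take Λ_{k−1} ∪ B(Λ_k) as Λ_{k−1}»), p. 90 («hence u₁
satisfies the conditions (1.29)»); T. Bałaban, *Averaging operations for lattice gauge theories*, Commun. Math. Phys. **98** (1985) 17–51 `[Balaban1985Averaging]` ("[3]"):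
p. 24 (locality of (43)); T. Bałaban, *Renormalization group approach to lattice gauge field theories. I*, Commun. Math. Phys. **109** (1987) 249–301 `[Balaban1987RG1]`
("[I]"): (0.3)–(0.4) pp. 252–253, pp. 253–254.  STATUS: published, refereed.

CITATION HEADER (lean-in-tree rule).  Cell `pub-ymgap`, base `pub-ymgap-dag-n05-c` g26 — N05-REC stage 2 (director-ym №254∕№255), item R5, LEAD PEN dag-n05-e
g35 (inventory `N05-REC-INVENTORY.md` e50db04501ab292d §R5 row `B8Prop5SocketDatum`: A `restr129_succ_of_truncation inAx_congr_of_towers`).  WHAT IS REPRODUCED =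
the two on-path theorems of ✓`B8Prop5SocketDatum` under the cell's TOKEN RULE over dag-n05-d's R2∕R4 record twins (`B8Ineq130Rec`: CENTRED towers `tlo ∕ thi`,
`block_mem ∕ smul_mem ∕ agree_level` for odd `L = 2s+1`; `B8Eq119TwistedAxialRec`: `UnderZ ∕ underZ_tower ∕ InAxZ ∕ inAxZ_iff ∕ Restr129Z`) and this seat's
`B8Eq178AveragesRec ∕ B8Thm4TruncationLocalRec` (`Cond168Z`, `restr129Z_of_cond168Z`, `restr129Z_truncate_iff_cond168Z`, centred blocks `blockSitesZ`); the engine's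
`inBox_of_le ∕ axialFn_congr` are structure-free, REUSED BY NAME.  The locality theorem carries the record's standing hypothesis `L = 2s + 1` (odd `L`,
centred blocks) that n05-d's tower lemmas carry.  Kind «kernel-checked proof», theorems only; no `def`, no `instance`, no `notation`, no existing module modified.
`--supports stmt-QuantumFields-20541` (K0⁷-keyed, COUNT-NEUTRAL).

HONEST SCOPE: locality bookkeeping + pure logic; NO inequality of [3]∕[6]∕[I]; the engine's §2–§4, §6–§7 (masked exponent, (1.69) from Proposition 3, source term,
join binders) are structure-free or off the record crown's path and are NOT twinned here; `HThm4Rec` UNDISCHARGED; caveat (C-S3-1) stands; N05 [B8] DISCHARGED OF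
RECORD untouched; COUNT 7∕28 (7∕27 excl. NODE O) · K 1∕4 UNMOVED; one finite `𝕋⁴` programme at fixed `ε`, Bałaban AS PRINTED; nothing continuum ∕ ℝ⁴ ∕ OS ∕ mass-gap
∕ Clay.  No `sorry`, no `def`.

[cite: Balaban1985RegularSpaces, (1.19)–(1.20) p.79, (1.29) p.81, (1.34) p.82, (1.68) p.88, pp.89–90; Balaban1985Averaging, p.24; Balaban1987RG1, (0.3)–(0.4) pp.252–253]
-/

noncomputable section

open NormedSpace

namespace Literature.MathematicalPhysics.QuantumFieldTheory.Balaban1983to89.B8Prop5SocketDatumRec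

open B7Prop1Explicit B7Prop2Explicit B7Prop1Local
open BlockAveragingZd (offZ avgIterZ)
open B8Ineq130 (inBox_of_le axialFn_congr)
open B8Ineq130Rec (tlo thi block_mem smul_mem agree_level)
open B8Eq119TwistedAxialRec (UnderZ underZ_tower InAxZ inAxZ_iff Restr129Z)
open B7SectEFLinearisationRec (blockSitesZ)
open B8Thm4TruncationLocalRec (restr129Z_of_cond168Z restr129Z_truncate_iff_cond168Z)

-- `Site` alone could resolve to the torus sites of `Setup.lean`; re-export the `ℤ^d` sites of `B7Prop1Explicit`.
export B7Prop1Explicit (Site)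

variable {d : ℕ}

/-! ## §1 LOCALITY OF THE AXIAL CLASS `Ax_k(𝔅_k, U₀)` (1.19) ON THE CENTRED TOWERS -/

section AxLocal

variable {𝔸 : Type*} [CStarAlgebra 𝔸]

/-- **`Ax_k(𝔅_k, U₀)` (record structure) is LOCAL ON THE CENTRED TOWERS** (twin of `inAx_congr_of_towers`): if `W` and `W′` agree on every bond with both
end-points in a centred tower `Bʲ(y)`, `y ∈ Λ_j`, `1 ≤ j ≤ k` (`AgreeOn (tlo L y j) (thi L y j) W W′`, dag-n05-d's centred towers), then
`W ∈ Ax_k(𝔅_k, U₀) ⟺ W′ ∈ Ax_k(𝔅_k, U₀)` for the record averages `avgIterZ` — locality of (43) (`B8Ineq130Rec.agree_level`) along the (1.7) staircases inside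
the blocks (`axialFn_congr`); odd `L = 2s + 1`. [cite: Balaban1985RegularSpaces, (1.19)–(1.20) p.79, (1.34) p.82; Balaban1985Averaging, p.24; Balaban1987RG1, (0.3) p.252] -/
theorem inAxZ_congr_of_towers {L s : ℕ} (hL : L = 2 * s + 1) (k : ℕ) (Λ : ℕ → Set (Site d)) (U₀ W W' : Site d → Fin d → 𝔸ˣ)
    (h : ∀ j, 1 ≤ j → j ≤ k → ∀ y ∈ Λ j, AgreeOn (tlo L y j) (thi L y j) W W') :
    InAxZ L k Λ U₀ W ↔ InAxZ L k Λ U₀ W' := by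
  have hLodd : Odd L := ⟨s, by omega⟩
  have key : ∀ {V V' : Site d → Fin d → 𝔸ˣ}, (∀ j, 1 ≤ j → j ≤ k → ∀ y ∈ Λ j, AgreeOn (tlo L y j) (thi L y j) V V') →
      ∀ j, 1 ≤ j → j ≤ k → ∀ y ∈ Λ j, ∀ n, n < j → ∀ z : Site d, UnderZ L (j - (n + 1)) y z → ∀ r : Fin d → Fin L,
        axialFn (avgIterZ L V n) ((L : ℤ) • z) ((L : ℤ) • z + offZ L r) =
          axialFn (avgIterZ L V' n) ((L : ℤ) • z) ((L : ℤ) • z + offZ L r) := by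
    intro V V' hVV j hj1 hjk y hy n hn z hz r
    have hA : AgreeOn (tlo L y (j - n)) (thi L y (j - n)) (avgIterZ L V n) (avgIterZ L V' n) :=
      agree_level hL n (j - n) (by rw [Nat.sub_add_cancel hn.le]; exact hVV j hj1 hjk y hy)
    obtain ⟨hz1, hz2⟩ := underZ_tower (lo := y) (hi := y) (m₀ := 0) hLodd (by simp) (by simp) hz
    rw [Nat.zero_add] at hz1 hz2
    obtain ⟨h1, h2⟩ := block_mem hL hz1 hz2 r
    obtain ⟨h3, h4⟩ := smul_mem hz1 hz2
    rw [show j - (n + 1) + 1 = j - n by omega] at h1 h2 h3 h4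
    exact axialFn_congr hA _ _ (inBox_of_le h3 h4) (inBox_of_le h1 h2)
  rw [inAxZ_iff, inAxZ_iff]
  constructor
  · intro H j hj1 hjk y hy n hn z hz r
    rw [← key h j hj1 hjk y hy n hn z hz r]
    exact H j hj1 hjk y hy n hn z hz r
  · intro H j hj1 hjk y hy n hn z hz r
    rw [key h j hj1 hjk y hy n hn z hz r]
    exact H j hj1 hjk y hy n hn z hz r

end AxLocal

/-! ## §5 (1.29) LIFTED from the truncated structure to the full one (index law №8), record structure -/

section Lift

variable {𝔸 : Type*} [NormedRing 𝔸] [NormedAlgebra ℂ 𝔸] [CompleteSpace 𝔸]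

/-- **«hence u₁ satisfies the conditions (1.29)»** (p. 90) at `m + 1` levels, from (1.29) at `m` levels for the TRUNCATED structure, record edition (twin of
`restr129_succ_of_truncation`): if `Λs m j = Λs (m+1) j` for `j < m` and `Λs m m = Λs (m+1) m ∪ B(Λs (m+1) (m+1))` with the CENTRED blocks `blockSitesZ`, then
`Restr129Z L m (Λs m) U₀ u₁ → Restr129Z L (m+1) (Λs (m+1)) U₀ u₁`. [cite: Balaban1985RegularSpaces, p.90 (sentence before (1.78)), (1.68) p.88, (1.29) p.81, p.89] -/
theorem restr129Z_succ_of_truncation {L : ℕ} (hL : 1 ≤ L) {m : ℕ} {Λs : ℕ → ℕ → Set (Site d)}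
    (hlt : ∀ j, j < m → Λs m j = Λs (m + 1) j)
    (htop : ∀ x, x ∈ Λs m m ↔ x ∈ Λs (m + 1) m ∨ ∃ y ∈ Λs (m + 1) (m + 1), x ∈ blockSitesZ L y)
    {U₀ : Site d → Fin d → 𝔸ˣ} {u₁ : Site d → 𝔸ˣ} (h129 : Restr129Z L m (Λs m) U₀ u₁) :
    Restr129Z L (m + 1) (Λs (m + 1)) U₀ u₁ :=
  restr129Z_of_cond168Z hL ((restr129Z_truncate_iff_cond168Z (Λ := Λs (m + 1)) (Λ' := Λs m) hlt htop U₀ u₁).1 h129)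

end Lift

end Literature.MathematicalPhysics.QuantumFieldTheory.Balaban1983to89.B8Prop5SocketDatumRec

end
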